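import Summits.ABC.ABC.Theorems.DefiniteXiDefiniteRTControlPrime
import Summits.ABC.ABC.Theorems.IsogenyGlueCongruenceMazurKenkuBoundOfRadius
import HarnessLib

/-!
# Stub ideas k3 (gen 9, FAMILY 3 — probe the extremes) — `stub_pastenLemma68 : PastenShimura2024_lemma_6_8`
(crux `DefiniteRTControlPrime`, stmt-ABC-11338, route `DefiniteXi`; skeleton `Lines/Sketch.lean:79`).
Companion of `STUB-IDEAS-stub_pastenLemma68-3.md` (gen 9; supersedes the gen-8 k3 file of that name).
No new imports beyond two LANDED Theorems modules; `lean check` rc 0, `sorry` only in the two stubs of §C.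

* §A  THE BRACKET (extremes of hypothesis strength).  The stub sits between
  `NonIntegralPrimeDegreeBound 163` (NECESSARY, tree: a prime-degree `ℚ`-isogeny out of a curve with a
  multiplicative place has `ℓ ≤ 163` — Mazur 1978 Thm 1 on non-integral `j`; at odd places this is
  exactly `Mazur1978.cor44_valuation_j_le_one`, stmt-ABC-18223) and `NonIntegralClassRadius 163`
  (SUFFICIENT: the radius item stmt-ABC-15193 demanded only on classes that meet the stub's domain).
  Both brackets are Mazur-deep, so restricting to non-integral `j` does not shrink the formal debt; the
  sharp constant in print is `25` (`Lemma68Const`, A5), irrelevant to the crux (its `C` is free).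
* §B  THE LANDABLE CLOSER over landed theorems only (p97354 `definiteRTControlPrime_of_facts`, landed
  `mazurKenkuBound_of_radiusItem`): `DefiniteRTControlPrime` from Takahashi 2.3 + the radius item — both
  Pasten fact-stubs (`stub_pasten163`, `stub_pastenLemma68`) are the SAME input.
* §C  the 2-stub skeleton this seat recommends registering (sorried stubs + kernel-checked composition).
-/

noncomputable section

-- `Summit.ABC.ABC` is the mandated summit-side namespace; the duplicate is deliberate.
set_option linter.dupNamespace false

open scoped Classical
open WeierstrassCurve IsDedekindDomain
open Literature.NumberTheory.EllipticCurves Literature.NumberTheory.EllipticCurves.ModularForms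
open Summit.ABC.ABC.Theses.DefiniteXi

namespace Summit.ABC.ABC.Cruxes.DefiniteRTControlPrime.StubIdeas3G9

/-! ## §A  The bracket: necessary ⇐ stub ⇐ sufficient, all on NON-INTEGRAL-`j` classes -/

/-- **Upper bracket (sufficient).** The Mazur–Kenku radius demanded ONLY on isogeny classes that meet
the stub's domain (a place of multiplicative reduction, i.e. non-integral `j`): Kenku's rows
`11,14,19,27,37,43,67,163` (integral / CM `j`) are vacuous here. -/
def NonIntegralClassRadius (R : ℕ) : Prop :=
  ∀ (W W' : WeierstrassCurve ℚ) [W.IsElliptic] [W'.IsElliptic], W.IsIsogenous W' →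
    (∃ v : HeightOneSpectrum ℤ, W.HasMultiplicativeReductionAt v) →
      ∃ φ : Isogeny W W', φ.degree ≤ R

/-- **Lower bracket (necessary).** No `ℚ`-isogeny of prime degree `> R` out of a curve with a place
of multiplicative reduction (`R = 163`: Mazur 1978 Thm 1 for non-integral `j`; at an ODD place it is
Mazur's Cor. 4.4 = `Mazur1978.cor44_valuation_j_le_one`, stmt-ABC-18223; at `v = 2` the level-`17`
points of `X₀(17)` are themselves multiplicative at `2`, so only `ℓ > 163` is excluded there). -/
def NonIntegralPrimeDegreeBound (R : ℕ) : Prop :=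
  ∀ (W W' : WeierstrassCurve ℚ) [W.IsElliptic] [W'.IsElliptic] (φ : Isogeny W W') (ℓ : ℕ),
    ℓ.Prime → φ.degree = ℓ → (∃ v : HeightOneSpectrum ℤ, W.HasMultiplicativeReductionAt v) → ℓ ≤ R

/-- **Lemma 6.8 with constant `B`** (the stub is `B = 163` verbatim, A4). -/
def Lemma68Const (B : ℕ) : Prop :=
  ∀ (W W' : WeierstrassCurve ℚ) [W.IsElliptic] [W'.IsElliptic], W.IsIsogenous W' →
    ∀ v : HeightOneSpectrum ℤ, W.HasMultiplicativeReductionAt v →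
      ∃ m n : ℕ, 0 < m ∧ m ≤ B ∧ 0 < n ∧ n ≤ B ∧
        W.ordMinimalDiscriminant v * n = W'.ordMinimalDiscriminant v * m

/-- **A1 (PROVED, trivial).** The route's radius item (stmt-ABC-15193) gives the upper bracket. -/
theorem nonIntegralClassRadius_of_radiusItem (hR : MazurKenkuRadius) : NonIntegralClassRadius 163 :=
  fun W W' _ _ hiso _ ↦ hR W W' hiso

/-- **A2 (PROVED; Mazur-free).** Radius `B` on non-integral classes ⇒ Lemma 6.8 with constant `B`:
cyclic companion (`Isogeny.exists_isCyclic_degree_dvd`) + the tree's Tate-curve transport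
`c_v(W)·b = c_v(W')·a`, `ab ∣ deg` (`exists_ordMinimalDiscriminant_mul_eq_mul_of_isCyclic`).
[cite: PastenShimura2024, Lemma 6.8 (p. 22)] -/
theorem lemma68Const_of_nonIntegralClassRadius (B : ℕ) (hR : NonIntegralClassRadius B) :
    Lemma68Const B := by
  intro W W' _ _ hiso v hv
  obtain ⟨φ, hB⟩ := hR W W' hiso ⟨v, hv⟩
  have hv' : W'.HasMultiplicativeReductionAt v := hasMultiplicativeReductionAt_of_isIsogenous ⟨φ⟩ v hv
  obtain ⟨ψ, hcyc, hdvd⟩ := φ.exists_isCyclic_degree_dvd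
  obtain ⟨a, b, ha, hb, hab, h⟩ :=
    exists_ordMinimalDiscriminant_mul_eq_mul_of_isCyclic ψ.degree ψ hcyc rfl v hv hv'
  have habn : a * b ≤ B := (Nat.le_of_dvd φ.degree_pos (hab.trans hdvd)).trans hB
  refine ⟨a, b, ha, ?_, hb, ?_, h⟩
  · have : a ≤ a * b := Nat.le_mul_of_pos_right a hb
    omega
  · have : b ≤ a * b := Nat.le_mul_of_pos_left b ha
    omega

/-- **A3 (PROVED, tree).** The stub implies the lower bracket (`prime_degree_le_163_of_PastenShimura2024_lemma_6_8`:
`m/n = ℓ^{±1}` with `m, n ≤ 163`). So the stub is Mazur-deep AS TYPED. [cite: Mazur1978, Thm. 1] -/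
theorem nonIntegralPrimeDegreeBound_of_stub (h68 : PastenShimura2024_lemma_6_8) :
    NonIntegralPrimeDegreeBound 163 := by
  intro W W' _ _ φ ℓ hℓ hdeg hv
  obtain ⟨v, hv⟩ := hv
  exact prime_degree_le_163_of_PastenShimura2024_lemma_6_8 h68 φ hℓ hdeg v hv

/-- **A4.** The stub IS `Lemma68Const 163` (and the route item `IsogenyValuationTransport`, stmt-ABC-18928). -/
theorem stub_iff_lemma68Const : PastenShimura2024_lemma_6_8 ↔ Lemma68Const 163 := Iff.rfl

theorem stub_iff_item : PastenShimura2024_lemma_6_8 ↔ IsogenyValuationTransport := Iff.rfl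

/-- **A5 (PROVED).** The stub from the upper bracket; with `B = 25` the same term is the SHARP printed form
(the cyclic `ℚ`-isogeny degrees of non-integral-`j` curves are `{1,…,10,12,13,15,16,17,18,21,25}`:
Kenku's rows `11,14,19,27,37,43,67,163` have integral `j`). -/
theorem stub_of_nonIntegralClassRadius (hR : NonIntegralClassRadius 163) : PastenShimura2024_lemma_6_8 :=
  lemma68Const_of_nonIntegralClassRadius 163 hR

/-- **A6 (PROVED).** … hence from the radius item: the closer-in-waiting for the stub prover
(`exact stub_of_radiusItem hR` the day stmt-ABC-15193 closes). -/
theorem stub_of_radiusItem (hR : MazurKenkuRadius) : PastenShimura2024_lemma_6_8 :=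
  stub_of_nonIntegralClassRadius (nonIntegralClassRadius_of_radiusItem hR)

/-- **A7 (statement only — the extremal FACT, certified numerically, not needed by the crux).** Lemma 6.8's
constant is SHARP at `25`: `Lemma68Const 24` fails.  Witness (PARI `ellisomat`, database-free; kit jobs
j344974 / j344979): the `ℚ`-isogeny class of conductor `550` through `[1,1,1,197,681]`
(`Δ_min = −2⁵·5³·11⁵`) has degree matrix `[1,5,5; 5,1,25; 5,25,1]` and `c₂ = (5, 25, 1)` at the
multiplicative prime `2` — ratio `25` along the cyclic `25`-isogeny (monotone pattern: one of the two rational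
`5`-lines of the middle curve is the toric line at `2`).  Sporadic levels: `c₂ = (1, 17)` on the `X₀(17)` pair
(conductor `14450`), `c₂ = (1, 3, 7, 21)` on the `X₀(21)` class `162`.  A Lean proof would need three explicit
curves and two explicit `5`-isogenies (Vélu) — size L, no bearing on the crux (`C` is free there). -/
def Lemma68Sharp : Prop := Lemma68Const 25 ∧ ¬ Lemma68Const 24

/-! ## §B  The landable closer: Takahashi 2.3 + the radius item ⇒ the crux (over LANDED theorems only) -/

/-- **B1 (PROVED).** The `163`-fact-stub from the radius item: the landed
`Summit.ABC.ABC.Theorems.mazurKenkuBound_of_radiusItem` (Edixhoven integrality discharged in the tree),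
read through the definitional equalities `DefiniteXi.MazurKenkuRadius = RibetTakahashiSplit.MazurKenkuRadius`,
`IsogenyGlueCongruence.MazurKenkuBound = PastenShimura2024_minimalDegree_le_163_mul`. -/
theorem pasten163_of_radiusItem (hR : MazurKenkuRadius) : PastenShimura2024_minimalDegree_le_163_mul :=
  Summit.ABC.ABC.Theorems.mazurKenkuBound_of_radiusItem hR

/-- **B2 (PROVED) — the text of `Theorems/DefiniteXiDefiniteRTControlPrimeOfRadius.lean`
(`--supports stmt-ABC-11338`).** The crux from Takahashi 2001 Thm 2.3 and the Mazur–Kenku radius item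
ALONE: both Pasten leaves of p97354 are fed by the one radius hypothesis.
[cite: Takahashi2001, Thm. 2.3 (p. 79)] [cite: PastenShimura2024, §3 p. 13, Lemma 6.8 (p. 22)]
[cite: Mazur1978, Thm. 1] [cite: Kenku1982, Thm. 1] -/
theorem definiteRTControlPrime_of_takahashi_of_radiusItem (hT : takahashi2001_thm_2_3_of_coprime)
    (hR : MazurKenkuRadius) : DefiniteRTControlPrime :=
  Summit.ABC.ABC.Theorems.DefiniteRTControlPrime.definiteRTControlPrime_of_facts hT
    (pasten163_of_radiusItem hR) (stub_of_radiusItem hR)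

end Summit.ABC.ABC.Cruxes.DefiniteRTControlPrime.StubIdeas3G9

/-! ## §C  The 2-stub skeleton this seat recommends registering in place of `Lines/Sketch.lean`
(both Pasten fact-stubs leave the registry; the line's open debt is then named by items, not facts). -/

namespace Summit.ABC.ABC.Cruxes.DefiniteRTControlPrime.RadiusSketch

open Summit.ABC.ABC.Cruxes.DefiniteRTControlPrime.StubIdeas3G9

/-- Item-by-name signature of the second stub (= route item stmt-ABC-15193, `DefiniteXi.MazurKenkuRadius`). -/
def Sig.stub_radius : Prop := Summit.ABC.ABC.Theses.DefiniteXi.MazurKenkuRadius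

/-- stub 1/2 — Takahashi 2001 Thm 2.3 at `r ∥ N` (named Literature fact; its own STUB-IDEAS files). -/
theorem stub_takahashi : takahashi2001_thm_2_3_of_coprime := by
  sorry

/-- stub 2/2 — the Mazur–Kenku radius (route item stmt-ABC-15193; live line `radius-lite` under
`Cruxes/MazurKenkuBound`: residual stubs `stub_cor44` (stmt-ABC-18223), `stub_jTables7`, `stub_liteLevels5`). -/
theorem stub_radius : Sig.stub_radius := by
  sorry

/-- The kernel-checked composition: the crux BY NAME from the two stubs. -/
theorem DefiniteRTControlPrime_of : Summit.ABC.ABC.Theses.DefiniteXi.DefiniteRTControlPrime :=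
  definiteRTControlPrime_of_takahashi_of_radiusItem stub_takahashi stub_radius

end Summit.ABC.ABC.Cruxes.DefiniteRTControlPrime.RadiusSketch

end
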